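import Literature.AlgebraicGeometry.Resolution.DerivativeIdeals
import Mathlib.RingTheory.MvPolynomial.Ideal
import Mathlib.RingTheory.Ideal.Maps
import HarnessLib

/-!
# Derivative ideals and orders at points of `𝔸ⁿ` (BGMW Lemma 3.5.2, reverse inclusion; tangent directions)

Topic: `Literature/AlgebraicGeometry/Resolution`. Companion of `DerivativeIdeals.lean`: the
characteristic-sensitive half of Bierstone–Grigoriev–Milman–Włodarczyk (arXiv:1206.3090)
Lemma 3.5.2, `supp(𝓘, μ) = supp(𝒟ⁱ(𝓘), μ - i)`, at the origin of affine space and for `i = 1`,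
with the hypothesis made explicit in BGMW §8 (Thm. 8.0.4: the characteristic-zero lemmas hold
"with the hypothesis … that the multiplicity is less than characteristic `p`"): if the integers
`1, …, ν` are nonzero in the coefficient ring `k` (without zero divisors), a polynomial of order
exactly `ν ≥ 1` at `0` has a partial derivative of order `< ν`, hence `𝒟(I) ⊄ 𝔪ᵛ` whenever
`ord_0 I = ν` — PROVED (`Mathlib`'s `MvPolynomial.idealOfVars`, `coeff_pderiv`):

* `exists_pderiv_not_mem_pow_idealOfVars`;
* `derivIdeal_not_le_pow_idealOfVars`; `derivIdealIter_not_le_pow_idealOfVars` (`ord_0 𝒟ⁱ(I) = ν - i`);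
* `exists_mem_derivIdealIter_mem_idealOfVars_not_mem_sq` — **existence of a tangent direction
  (BGMW Def. 3.6.5; an equation of a hypersurface of maximal contact, §3.6) at the origin**: for
  `ord_0 I = μ ≥ 1` there is `u ∈ 𝒟^{μ-1}(I)` of order one at `0` — PROVED under `1, …, μ ≠ 0`
  (the only use of characteristic zero in BGMW, p. 5);
* `map_derivIdeal_le`, `derivIdeal_map_algEquiv`, `derivIdealIter_map_algEquiv` — **`𝒟` commutes
  with isomorphisms of `R`-algebras**; `exists_algEquiv_translate`, `idealOfVars_map_translate`,
  `exists_mem_derivIdealIter_mem_not_mem_sq_point` — the same at every `k`-point `a` of `𝔸ⁿ`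
  (`𝔪_a = (x_i - a_i)`), by translation.

## Sources

* [BGMW 2011] §3.5 Lemma 3.5.2; §3.6 Def. 3.6.1, Def. 3.6.5; §2 p. 5; §8 Thm. 8.0.4 (arXiv numbering).
  [BierstoneGrigorievMilmanWlodarczyk2011]
-/

-- `open` before `namespace`: inside `Literature.AlgGeom`, `open MvPolynomial` would resolve to the
-- sub-namespace `Literature.AlgGeom.MvPolynomial` of `DerivativeIdeals.lean` only.
open MvPolynomial

namespace Literature.AlgebraicGeometry.Resolution

/-! ## Orders at the origin of affine space: a derivative drops the order by exactly one
(when `1, …, ν` are nonzero in the coefficient ring — BGMW's "multiplicity `< p`") -/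

section Origin

variable {k : Type*} [CommRing k] {σ : Type*}

/-- **At the origin of `𝔸ⁿ`, some partial derivative lowers the order by one**, provided the
integers `1, …, ν` are nonzerodivisors… concretely nonzero in `k` with `k` without zero divisors
(automatic in characteristic `0`; in characteristic `p` this is `ν < p`, the modification of BGMW
§8, Thm. 8.0.4: "we replace the hypothesis of characteristic zero with the one that the
multiplicity `μ` … is less than characteristic `p`"): if `f ∈ 𝔪ᵛ ∖ 𝔪ᵛ⁺¹`, `𝔪 = (x_1, …, x_n)`,
`ν ≥ 1`, then `∂f/∂xᵢ ∉ 𝔪ᵛ` for some `i` (the Taylor-expansion argument of BGMW Lemma 3.2.1 /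
Lemma 3.5.2). [cite: BierstoneGrigorievMilmanWlodarczyk2011, Lemma 3.5.2 with Thm. 8.0.4] -/
theorem exists_pderiv_not_mem_pow_idealOfVars [NoZeroDivisors k]
    {f : MvPolynomial σ k} {ν : ℕ} (hν : ν ≠ 0) (hf : f ∈ idealOfVars σ k ^ ν)
    (hf' : f ∉ idealOfVars σ k ^ (ν + 1)) (hchar : ∀ j : ℕ, 0 < j → j ≤ ν → (j : k) ≠ 0) :
    ∃ i : σ, pderiv i f ∉ idealOfVars σ k ^ ν := by
  classical
  rw [MvPolynomial.mem_pow_idealOfVars_iff] at hf hf'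
  push Not at hf'
  obtain ⟨α, hα, hlt⟩ := hf'
  have hdeg : Finsupp.degree α = ν := le_antisymm (Nat.lt_succ_iff.mp hlt) (hf α hα)
  -- `α ≠ 0` since `ν ≠ 0`: pick `i` with `α i ≠ 0`
  have hα0 : α ≠ 0 := by
    rintro rfl
    rw [map_zero] at hdeg
    exact hν hdeg.symm
  obtain ⟨i, hi⟩ : ∃ i, α i ≠ 0 := by
    by_contra h
    push Not at h
    exact hα0 (Finsupp.ext fun i => by simpa using h i)
  refine ⟨i, fun hmem => ?_⟩
  rw [MvPolynomial.mem_pow_idealOfVars_iff] at hmem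
  -- the monomial `β = α - eᵢ` of `∂f/∂xᵢ` has degree `ν - 1 < ν` and nonzero coefficient
  set β : σ →₀ ℕ := α - Finsupp.single i 1 with hβ
  have hβα : β + Finsupp.single i 1 = α := by
    rw [hβ]
    exact tsub_add_cancel_of_le (Finsupp.single_le_iff.mpr (Nat.one_le_iff_ne_zero.mpr hi))
  have hcoeff : (pderiv i f).coeff β ≠ 0 := by
    rw [MvPolynomial.coeff_pderiv, hβα]
    refine mul_ne_zero (MvPolynomial.mem_support_iff.mp hα) ?_
    have hβi : β i + 1 = α i := by
      have := congrArg (fun γ : σ →₀ ℕ => γ i) hβα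
      simpa [Finsupp.add_apply, Finsupp.single_eq_same] using this
    have hle : α i ≤ ν := hdeg ▸ Finsupp.le_degree i α
    exact_mod_cast hchar (α i) (Nat.pos_of_ne_zero hi) hle ∘ (by rw [← hβi]; exact_mod_cast id)
  have hβdeg : Finsupp.degree β < ν := by
    have : Finsupp.degree β + 1 = ν := by
      rw [← hdeg, ← hβα, map_add, Finsupp.degree_single]
    omega
  exact absurd (hmem β (MvPolynomial.mem_support_iff.mpr hcoeff)) (not_le.mpr hβdeg)

/-- **BGMW Lemma 3.5.2, reverse inclusion at the origin of `𝔸ⁿ`** (ring form): if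
`I ⊆ 𝔪ᵛ` but `I ⊄ 𝔪ᵛ⁺¹` (`ord_0 I = ν ≥ 1`) and `1, …, ν ≠ 0` in `k`, then `𝒟(I) ⊄ 𝔪ᵛ`, i.e.
`ord_0 𝒟(I) = ν - 1` (with `derivIdeal_le_pow_sub_one`): `0 ∉ supp(I, ν+1) ⇒ 0 ∉ supp(𝒟(I), ν)`.
[cite: BierstoneGrigorievMilmanWlodarczyk2011, Lemma 3.5.2 with Thm. 8.0.4] -/
theorem derivIdeal_not_le_pow_idealOfVars [NoZeroDivisors k] {I : Ideal (MvPolynomial σ k)} {ν : ℕ}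
    (hν : ν ≠ 0) (hI : I ≤ idealOfVars σ k ^ ν) (hI' : ¬ I ≤ idealOfVars σ k ^ (ν + 1))
    (hchar : ∀ j : ℕ, 0 < j → j ≤ ν → (j : k) ≠ 0) :
    ¬ derivIdeal k I ≤ idealOfVars σ k ^ ν := by
  intro h
  obtain ⟨f, hfI, hf'⟩ := SetLike.not_le_iff_exists.mp hI'
  obtain ⟨i, hi⟩ := exists_pderiv_not_mem_pow_idealOfVars hν (hI hfI) hf' hchar
  exact hi (h (apply_mem_derivIdeal k (pderiv i) hfI))

end Origin

/-! ## Iterating: `ord_0 𝒟ⁱ(I) = ν - i`; tangent directions (maximal contact) at the origin -/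

section Tangent

variable {k : Type*} [CommRing k] [NoZeroDivisors k] {σ : Type*}

/-- Iterated form: if `ord_0 I = ν` and `1, …, ν ≠ 0` in `k`, then `𝒟ⁱ(I) ⊄ 𝔪^{ν-i+1}` for all
`i < ν` (with `derivIdealIter_le_pow_sub`: `ord_0 𝒟ⁱ(I) = ν - i` exactly) — BGMW Lemma 3.5.2 at
the origin of `𝔸ⁿ`. [cite: BierstoneGrigorievMilmanWlodarczyk2011, Lemma 3.5.2 with Thm. 8.0.4] -/
theorem derivIdealIter_not_le_pow_idealOfVars {I : Ideal (MvPolynomial σ k)} {ν : ℕ}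
    (hI : I ≤ idealOfVars σ k ^ ν) (hI' : ¬ I ≤ idealOfVars σ k ^ (ν + 1))
    (hchar : ∀ j : ℕ, 0 < j → j ≤ ν → (j : k) ≠ 0) :
    ∀ i : ℕ, i < ν → ¬ derivIdealIter k i I ≤ idealOfVars σ k ^ (ν - i + 1) := by
  intro i
  induction i with
  | zero => intro _; simpa using hI'
  | succ i ih =>
    intro hi
    have hi' : i < ν := Nat.lt_of_succ_lt hi
    have h1 : derivIdealIter k i I ≤ idealOfVars σ k ^ (ν - i) := derivIdealIter_le_pow_sub k hI i
    have h2 : ¬ derivIdealIter k i I ≤ idealOfVars σ k ^ (ν - i + 1) := ih hi'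
    have h3 := derivIdeal_not_le_pow_idealOfVars (Nat.sub_ne_zero_of_lt hi') h1 h2
      (fun j hj hjν => hchar j hj (hjν.trans (Nat.sub_le ν i)))
    rw [derivIdealIter_succ]
    have e : ν - (i + 1) + 1 = ν - i := by omega
    rwa [e]

/-- **Existence of a tangent direction at the origin of `𝔸ⁿ`** (BGMW Def. 3.6.5: "a function
`u ∈ T(𝓘)(U) := 𝒟^{μ-1}(𝓘(U))` of multiplicity one", locally defining a hypersurface of maximal
contact; by Lemma 3.5.2, `supp(𝓘, μ) = supp(𝒟^{μ-1}(𝓘), 1)`, such `u` exist near points of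
order `μ` — "The assumption of characteristic zero is only needed for the local existence of a
hypersurface of maximal contact", p. 5): if `ord_0 I = μ ≥ 1` (`I ⊆ 𝔪^μ`, `I ⊄ 𝔪^{μ+1}`) and
`1, …, μ ≠ 0` in `k` (characteristic zero, or `μ <` characteristic as in BGMW §8, Thm. 8.0.4),
then there is `u ∈ 𝒟^{μ-1}(I)` of order exactly one at `0` (`u ∈ 𝔪 ∖ 𝔪²`).
[cite: BierstoneGrigorievMilmanWlodarczyk2011, Def. 3.6.5 with Lemma 3.5.2] -/
theorem exists_mem_derivIdealIter_mem_idealOfVars_not_mem_sq {I : Ideal (MvPolynomial σ k)} {μ : ℕ}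
    (hμ : μ ≠ 0) (hI : I ≤ idealOfVars σ k ^ μ) (hI' : ¬ I ≤ idealOfVars σ k ^ (μ + 1))
    (hchar : ∀ j : ℕ, 0 < j → j ≤ μ → (j : k) ≠ 0) :
    ∃ u ∈ derivIdealIter k (μ - 1) I, u ∈ idealOfVars σ k ∧ u ∉ idealOfVars σ k ^ 2 := by
  have h1 : derivIdealIter k (μ - 1) I ≤ idealOfVars σ k ^ (μ - (μ - 1)) :=
    derivIdealIter_le_pow_sub k hI (μ - 1)
  have h2 := derivIdealIter_not_le_pow_idealOfVars hI hI' hchar (μ - 1) (Nat.sub_one_lt hμ)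
  have e1 : μ - (μ - 1) = 1 := by omega
  rw [e1, pow_one] at h1
  rw [e1] at h2
  obtain ⟨u, hu, hu'⟩ := SetLike.not_le_iff_exists.mp h2
  exact ⟨u, hu, h1 hu, hu'⟩

end Tangent

/-! ## Functoriality: `𝒟` commutes with isomorphisms of `R`-algebras (e.g. translations of `𝔸ⁿ`) -/

section Functorial

variable (R : Type*) {A B : Type*} [CommSemiring R] [CommRing A] [CommRing B] [Algebra R A]
  [Algebra R B]

/-- Derivatives of elements of `I` map into `𝒟(e(I))` under an `R`-algebra isomorphism `e`
(transport of derivations `δ ↦ e ∘ δ ∘ e⁻¹`). [folklore] -/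
theorem map_derivIdeal_le (e : A ≃ₐ[R] B) (I : Ideal A) :
    (derivIdeal R I).map (e : A →+* B) ≤ derivIdeal R (I.map (e : A →+* B)) := by
  rw [Ideal.map_le_iff_le_comap, derivIdeal_le_iff]
  refine ⟨fun f hf => ?_, fun δ f hf => ?_⟩
  · exact Ideal.mem_comap.mpr ((le_derivIdeal R _) (Ideal.mem_map_of_mem _ hf))
  · -- the transported derivation `e ∘ δ ∘ e⁻¹` of `B`
    let δ' : Derivation R B B :=
      { toLinearMap := (e : A →ₗ[R] B) ∘ₗ (δ : A →ₗ[R] A) ∘ₗ (e.symm : B →ₗ[R] A)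
        map_one_eq_zero' := by simp
        leibniz' := fun a b => by
          change e (δ (e.symm (a * b))) = a • e (δ (e.symm b)) + b • e (δ (e.symm a))
          rw [map_mul, Derivation.leibniz, map_add, smul_eq_mul, smul_eq_mul, map_mul, map_mul,
            e.apply_symm_apply, e.apply_symm_apply, smul_eq_mul, smul_eq_mul] }
    have hδ' : δ' (e f) = e (δ f) := by
      change e (δ (e.symm (e f))) = e (δ f)
      rw [e.symm_apply_apply]
    rw [Ideal.mem_comap]
    change e (δ f) ∈ _
    rw [← hδ']
    exact apply_mem_derivIdeal R δ' (Ideal.mem_map_of_mem _ hf)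

/-- **`𝒟` commutes with `R`-algebra isomorphisms**: `𝒟(e(I)) = e(𝒟(I))` (so all statements at
the origin of `𝔸ⁿ` transport to any `k`-point by a translation). [folklore] -/
theorem derivIdeal_map_algEquiv (e : A ≃ₐ[R] B) (I : Ideal A) :
    derivIdeal R (I.map (e : A →+* B)) = (derivIdeal R I).map (e : A →+* B) := by
  refine le_antisymm ?_ (map_derivIdeal_le R e I)
  -- apply the inclusion to `e⁻¹` and the ideal `e(I)`
  have h := map_derivIdeal_le R e.symm (I.map (e : A →+* B))
  have hee : (e.symm : B →+* A).comp (e : A →+* B) = RingHom.id A :=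
    RingHom.ext fun a => e.symm_apply_apply a
  have hee' : (e : A →+* B).comp (e.symm : B →+* A) = RingHom.id B :=
    RingHom.ext fun b => e.apply_symm_apply b
  have hI : (I.map (e : A →+* B)).map (e.symm : B →+* A) = I := by
    rw [Ideal.map_map, hee, Ideal.map_id]
  rw [hI] at h
  -- `h : (𝒟(e I)).map e⁻¹ ≤ 𝒟(I)`; apply `e`
  have h' := Ideal.map_mono (f := (e : A →+* B)) h
  rwa [Ideal.map_map, hee', Ideal.map_id] at h'

/-- Iterated: `𝒟ⁱ(e(I)) = e(𝒟ⁱ(I))`. [folklore] -/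
theorem derivIdealIter_map_algEquiv (e : A ≃ₐ[R] B) (i : ℕ) (I : Ideal A) :
    derivIdealIter R i (I.map (e : A →+* B)) = (derivIdealIter R i I).map (e : A →+* B) := by
  induction i with
  | zero => rfl
  | succ i ih => rw [derivIdealIter_succ, derivIdealIter_succ, ih, derivIdeal_map_algEquiv]

end Functorial

/-! ## Translating the origin: orders at a `k`-point `a ∈ 𝔸ⁿ(k)` -/

section Point

variable {k : Type*} [CommRing k] {σ : Type*}

/-- The translation `x ↦ x - a` of `𝔸ⁿ` as a `k`-algebra automorphism of `k[x_1, …, x_n]`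
(`xᵢ ↦ xᵢ - aᵢ`, inverse `xᵢ ↦ xᵢ + aᵢ`). [folklore] -/
theorem exists_algEquiv_translate (a : σ → k) :
    ∃ e : MvPolynomial σ k ≃ₐ[k] MvPolynomial σ k, ∀ i, e (X i) = X i - C (a i) := by
  refine ⟨AlgEquiv.ofAlgHom (aeval fun i => X i - C (a i)) (aeval fun i => X i + C (a i)) ?_ ?_,
    fun i => ?_⟩
  · ext i
    simp
  · ext i
    simp
  · simp

/-- **The maximal ideal `𝔪_a = (x_i - a_i)` of the `k`-point `a`** is the translate of
`𝔪_0 = (x_i)`. [folklore] -/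
theorem idealOfVars_map_translate {e : MvPolynomial σ k ≃ₐ[k] MvPolynomial σ k} {a : σ → k}
    (he : ∀ i, e (X i) = X i - C (a i)) :
    (idealOfVars σ k).map (e : MvPolynomial σ k →+* MvPolynomial σ k) =
      Ideal.span (Set.range fun i => X i - C (a i)) := by
  rw [idealOfVars, Ideal.map_span, ← Set.range_comp]
  congr 2
  funext i
  exact he i

/-- **Existence of a tangent direction at any `k`-point** `a` of `𝔸ⁿ` (BGMW Def. 3.6.5 with
Lemma 3.5.2, cf. `exists_mem_derivIdealIter_mem_idealOfVars_not_mem_sq`): if `ord_a I = μ ≥ 1`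
(`I ⊆ 𝔪_aᵘ`, `I ⊄ 𝔪_aᵘ⁺¹`, `𝔪_a = (x_i - a_i)`) and `1, …, μ ≠ 0` in `k`, there is
`u ∈ 𝒟^{μ-1}(I)` with `u ∈ 𝔪_a ∖ 𝔪_a²`. [cite: BierstoneGrigorievMilmanWlodarczyk2011, Def. 3.6.5 with Lemma 3.5.2] -/
theorem exists_mem_derivIdealIter_mem_not_mem_sq_point [NoZeroDivisors k] (a : σ → k)
    {I : Ideal (MvPolynomial σ k)} {μ : ℕ} (hμ : μ ≠ 0)
    (hI : I ≤ Ideal.span (Set.range fun i => X i - C (a i)) ^ μ)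
    (hI' : ¬ I ≤ Ideal.span (Set.range fun i => X i - C (a i)) ^ (μ + 1))
    (hchar : ∀ j : ℕ, 0 < j → j ≤ μ → (j : k) ≠ 0) :
    ∃ u ∈ derivIdealIter k (μ - 1) I, u ∈ Ideal.span (Set.range fun i => X i - C (a i)) ∧
      u ∉ Ideal.span (Set.range fun i => X i - C (a i)) ^ 2 := by
  obtain ⟨e, he⟩ := exists_algEquiv_translate a
  have hm := idealOfVars_map_translate he
  let ε : MvPolynomial σ k →+* MvPolynomial σ k := e
  let ε' : MvPolynomial σ k →+* MvPolynomial σ k := e.symm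
  have hee : ε'.comp ε = RingHom.id _ := RingHom.ext fun b => e.symm_apply_apply b
  have hee' : ε.comp ε' = RingHom.id _ := RingHom.ext fun b => e.apply_symm_apply b
  have hpow : ∀ n : ℕ, (idealOfVars σ k ^ n).map ε =
      Ideal.span (Set.range fun i => X i - C (a i)) ^ n := fun n => by
    rw [Ideal.map_pow]
    exact congrArg (· ^ n) hm
  -- move `I` back to the origin: `J := e⁻¹(I)`, `e(J) = I`
  obtain ⟨J, hJ⟩ : ∃ J : Ideal (MvPolynomial σ k), J = I.map ε' := ⟨_, rfl⟩
  have hIJ : J.map ε = I := by rw [hJ, Ideal.map_map, hee', Ideal.map_id]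
  have hmapJ : ∀ K : Ideal (MvPolynomial σ k), J ≤ K ↔ I ≤ K.map ε := fun K =>
    ⟨fun h => hIJ ▸ Ideal.map_mono h, fun h => by
      have h2 := Ideal.map_mono (f := ε') h
      rwa [Ideal.map_map, hee, Ideal.map_id, ← hJ] at h2⟩
  have hJ1 : J ≤ idealOfVars σ k ^ μ := (hmapJ _).mpr (by rw [hpow]; exact hI)
  have hJ2 : ¬ J ≤ idealOfVars σ k ^ (μ + 1) := fun h => hI' (by rw [← hpow]; exact (hmapJ _).mp h)
  obtain ⟨u, hu, hu1, hu2⟩ := exists_mem_derivIdealIter_mem_idealOfVars_not_mem_sq hμ hJ1 hJ2 hchar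
  refine ⟨ε u, ?_, ?_, ?_⟩
  · rw [← hIJ, derivIdealIter_map_algEquiv]
    exact Ideal.mem_map_of_mem _ hu
  · rw [← hm]
    exact Ideal.mem_map_of_mem _ hu1
  · rw [← hpow 2]
    intro h
    have h2 := Ideal.mem_map_of_mem ε' h
    rw [Ideal.map_map, hee, Ideal.map_id] at h2
    exact hu2 (by simpa [ε, ε'] using h2)

end Point

end Literature.AlgebraicGeometry.Resolution
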